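/-
Copyright (c) 2026. All rights reserved.
Released under Apache 2.0 license as described in the file LICENSE.
Authors: abc-iut cell, R-W prover seat abc-iut-W-neg-1 (gen 2).
-/
import Literature.IUT.LogVolume.EisensteinRadicalDifferent
import Literature.IUT.LogVolume.DifferentEstimatesCorollaries
import HarnessLib

/-!
# The different of a `p`-adic field containing a `p`-th root of a unit `u ∈ ℤ_p^×` with `u^{p−1} ≢ 1 (mod p²)`:
# `p ∣ e` and `d_K ≥ 1 + (e/p − 1)/e` (the case «W2» of the wild local type)

Classical local algebra (J.-P. Serre, *Corps locaux*, Ch. III §6 Prop. 13; E. Hecke, *Vorlesungen über die Theorie der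
algebraischen Zahlen*, §39, the ramification of Kummer extensions of prime degree: `ℚ_p(u^{1/p})/ℚ_p`, `u` a unit, is
totally (wildly) ramified unless `u` is a `p`-th power modulo `p²`, i.e. unless `u^{p−1} ≡ 1 (mod p²)`), in the norm-side
setting of the cell's [IUTchIV] §1 files (`e = absRamificationIdx p K`, `d = differentOrd p K`, `ord(p) = 1`).

Let `u ∈ ℚ_p` with `‖u^{p−1} − 1‖ = p⁻¹` and suppose `K` contains `y` with `y^p = u`. THIS FILE PROVES:

* `norm_eq_rpow_of_eisenstein_root` — a root `x` (in any ultrametric normed `ℚ_p`-algebra that is a field) of a monic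
  polynomial of degree `n` over `ℚ_p` whose lower coefficients have norm `≤ p⁻¹` and constant coefficient norm `= p⁻¹`
  (EISENSTEIN) has `‖x‖ = p^{−1/n}` (Newton polygon);
* `norm_pow_sub_one_pred_sub_one_of_pow_prime_eq_unit` — `x := y^{p−1} − 1` is such a root (of `(X+1)^p − u^{p−1}`), so
  `‖y^{p−1} − 1‖ = p^{−1/p}`; hence (`prime_dvd_absRamificationIdx_of_norm_eq_rpow`) **`p ∣ e`**;
* **`add_div_sub_one_div_le_differentOrd_of_pow_prime_eq_unit`: `(e + e/p − 1)/e ≤ d_K`** — the subfield `V = ℚ_p(x)` has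
  `e_V = p` (so `d_V ≥ 1`, wild) and [IUTchIV] Prop. 1.3 (i) (`prop13i_holds`: `d_K ≥ d_V + (e(K/V) − 1)/e_K`) gives the rest.
  Numerically `D ≥ e + e/p − 1` (`= 4e/3 − 1` at `p = 3`, `6e/5 − 1` at `p = 5`) — abc-iut W-num-2's exact `δ_w = (e_t − 1) +
  e_t·δ_W`, `(e_W, δ_W) = (6, 7), (20, 23)`, type W2 of N1-WILD-EXACT L5.

Consumer: the abc-iut R-W window table at the wild packets `p ∈ {3, 5}` with `p ∣ t` (Broberg `ℚ(√7)` at `3`, `h = 24`; plan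
C-R71 (2)): `y = ρ/p^{2t/p}` for a `p`-th root `ρ` of the Tate parameter `q₀ = p^{2t}·u`. PROOF-ONLY file (theorems, no
definitions, no named `Prop` facts); nothing here is disputed mathematics.
[cite: SerreLocalFields1979, Ch. III §6 Prop. 13] [cite: NeukirchANT1999, Ch. II Prop. (7.13)]
-/

noncomputable section

open Metric Set IsLocalRing Module Polynomial
open scoped NormedField IntermediateField

namespace Literature.IUT.LogVolume

/-! ## §1 Roots of Eisenstein polynomials -/

section Eisenstein

variable (p : ℕ) [Fact p.Prime]
variable {K : Type*} [NormedField K] [NormedAlgebra ℚ_[p] K] [IsUltrametricDist K]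

/-- **A root of an Eisenstein polynomial of degree `n` over `ℤ_p` has norm `p^{−1/n}`**: if
`x^n + Σ_{k<n} a_k x^k = 0` with `‖a_k‖ ≤ p⁻¹` and `‖a_0‖ = p⁻¹`, then `‖x‖ = p^{−1/n}` (the term `x^n` must cancel the constant
term; Newton polygon). [cite: NeukirchANT1999, Ch. II Prop. (7.13)] -/
theorem norm_eq_rpow_of_eisenstein_root {n : ℕ} (hn : 0 < n) (a : ℕ → ℚ_[p])
    (ha : ∀ k < n, ‖a k‖ ≤ (p : ℝ)⁻¹) (ha0 : ‖a 0‖ = (p : ℝ)⁻¹) {x : K}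
    (hx : x ^ n + ∑ k ∈ Finset.range n, algebraMap ℚ_[p] K (a k) * x ^ k = 0) :
    ‖x‖ = (p : ℝ) ^ (-(1 / (n : ℝ))) := by
  have hp1 : (1 : ℝ) < p := by exact_mod_cast (Fact.out : p.Prime).one_lt
  have hp0 : (0 : ℝ) < p := by positivity
  have hpinv : (p : ℝ)⁻¹ < 1 := inv_lt_one_of_one_lt₀ hp1
  have hpinv0 : (0 : ℝ) < (p : ℝ)⁻¹ := by positivity
  have hxn : ‖x‖ ^ n = ‖∑ k ∈ Finset.range n, algebraMap ℚ_[p] K (a k) * x ^ k‖ := by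
    rw [← norm_pow, show x ^ n = -∑ k ∈ Finset.range n, algebraMap ℚ_[p] K (a k) * x ^ k from
      eq_neg_of_add_eq_zero_left hx, norm_neg]
  have hterm : ∀ k < n, ‖algebraMap ℚ_[p] K (a k) * x ^ k‖ ≤ (p : ℝ)⁻¹ * ‖x‖ ^ k := fun k hk => by
    rw [norm_mul, norm_pow, norm_algebraMap']
    exact mul_le_mul_of_nonneg_right (ha k hk) (by positivity)
  -- Step 1: `‖x‖ ≤ 1`
  have hle : ‖x‖ ≤ 1 := by
    by_contra h
    push Not at h
    obtain ⟨m, rfl⟩ : ∃ m, n = m + 1 := ⟨n - 1, by omega⟩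
    have hbound : ‖x‖ ^ (m + 1) ≤ (p : ℝ)⁻¹ * ‖x‖ ^ m := by
      rw [hxn]
      refine IsUltrametricDist.norm_sum_le_of_forall_le_of_nonneg (by positivity) fun k hk => ?_
      rw [Finset.mem_range] at hk
      refine (hterm k hk).trans ?_
      exact mul_le_mul_of_nonneg_left (pow_le_pow_right₀ h.le (by omega)) hpinv0.le
    have hxm : 0 < ‖x‖ ^ m := by positivity
    rw [pow_succ] at hbound
    have : ‖x‖ ≤ (p : ℝ)⁻¹ := le_of_mul_le_mul_left (by linarith [hbound]) hxm
    linarith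
  -- Step 2: `‖x‖ < 1`
  have hlt : ‖x‖ < 1 := by
    rcases hle.lt_or_eq with h | h
    · exact h
    · exfalso
      have hbound : ‖x‖ ^ n ≤ (p : ℝ)⁻¹ := by
        rw [hxn]
        refine IsUltrametricDist.norm_sum_le_of_forall_le_of_nonneg hpinv0.le fun k hk => ?_
        rw [Finset.mem_range] at hk
        refine (hterm k hk).trans ?_
        rw [h, one_pow, mul_one]
      rw [h, one_pow] at hbound
      linarith
  -- Step 3: the constant term dominates: `‖x‖^n = p⁻¹`
  have hkey : ‖x‖ ^ n = (p : ℝ)⁻¹ := by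
    obtain ⟨m, rfl⟩ : ∃ m, n = m + 1 := ⟨n - 1, by omega⟩
    rw [hxn, Finset.sum_range_succ', pow_zero, mul_one]
    have hrest : ‖∑ k ∈ Finset.range m, algebraMap ℚ_[p] K (a (k + 1)) * x ^ (k + 1)‖ < (p : ℝ)⁻¹ := by
      have hb : ‖∑ k ∈ Finset.range m, algebraMap ℚ_[p] K (a (k + 1)) * x ^ (k + 1)‖ ≤ (p : ℝ)⁻¹ * ‖x‖ := by
        refine IsUltrametricDist.norm_sum_le_of_forall_le_of_nonneg (by positivity) fun k hk => ?_
        rw [Finset.mem_range] at hk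
        refine (hterm (k + 1) (by omega)).trans ?_
        rw [pow_succ]
        calc (p : ℝ)⁻¹ * (‖x‖ ^ k * ‖x‖) ≤ (p : ℝ)⁻¹ * (1 * ‖x‖) := by
              gcongr
              exact pow_le_one₀ (norm_nonneg _) hle
          _ = (p : ℝ)⁻¹ * ‖x‖ := by rw [one_mul]
      calc _ ≤ (p : ℝ)⁻¹ * ‖x‖ := hb
        _ < (p : ℝ)⁻¹ * 1 := by gcongr
        _ = (p : ℝ)⁻¹ := mul_one _
    have ha0' : ‖algebraMap ℚ_[p] K (a 0)‖ = (p : ℝ)⁻¹ := by rw [norm_algebraMap', ha0]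
    have hne : ‖∑ k ∈ Finset.range m, algebraMap ℚ_[p] K (a (k + 1)) * x ^ (k + 1)‖ ≠
        ‖algebraMap ℚ_[p] K (a 0)‖ := by rw [ha0']; exact hrest.ne
    rw [IsUltrametricDist.norm_add_eq_max_of_norm_ne_norm hne, ha0', max_eq_right hrest.le]
  have hn0 : n ≠ 0 := hn.ne'
  calc ‖x‖ = (‖x‖ ^ n) ^ ((n : ℝ)⁻¹) := (Real.pow_rpow_inv_natCast (norm_nonneg _) hn0).symm
    _ = ((p : ℝ) ^ (-1 : ℝ)) ^ ((n : ℝ)⁻¹) := by rw [hkey, Real.rpow_neg_one]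
    _ = (p : ℝ) ^ (-(1 / (n : ℝ))) := by
        rw [← Real.rpow_mul hp0.le]
        congr 1
        field_simp

/-- The binomial coefficients `C(p, k)`, `0 < k < p`, have `p`-adic norm `≤ p⁻¹`. [cite: SerreLocalFields1979, Ch. III §6 Prop. 13] -/
theorem Padic.norm_natCast_choose_le {k : ℕ} (hk0 : 0 < k) (hkp : k < p) :
    ‖((p.choose k : ℕ) : ℚ_[p])‖ ≤ (p : ℝ)⁻¹ := by
  have hpp : p.Prime := Fact.out
  obtain ⟨c, hc⟩ := hpp.dvd_choose_self hk0.ne' hkp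
  rw [hc, Nat.cast_mul, norm_mul, Padic.norm_p]
  have : ‖((c : ℕ) : ℚ_[p])‖ ≤ 1 := by simpa using Padic.norm_int_le_one (p := p) (c : ℤ)
  calc (p : ℝ)⁻¹ * ‖((c : ℕ) : ℚ_[p])‖ ≤ (p : ℝ)⁻¹ * 1 := by gcongr
    _ = (p : ℝ)⁻¹ := mul_one _

/-- **`‖y^{p−1} − 1‖ = p^{−1/p}` for `y^p = u`, `‖u^{p−1} − 1‖ = p⁻¹`**: `x = y^{p−1} − 1` is a root of the Eisenstein polynomial
`(X + 1)^p − u^{p−1} = X^p + Σ_{0<k<p} C(p,k) X^k + (1 − u^{p−1})`. [cite: SerreLocalFields1979, Ch. III §6 Prop. 13] -/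
theorem norm_pow_sub_one_pred_sub_one_of_pow_prime_eq_unit {u : ℚ_[p]} (hu : ‖u ^ (p - 1) - 1‖ = (p : ℝ)⁻¹)
    {y : K} (hy : y ^ p = algebraMap ℚ_[p] K u) :
    ‖y ^ (p - 1) - 1‖ = (p : ℝ) ^ (-(1 / (p : ℝ))) := by
  have hpp : p.Prime := Fact.out
  set x : K := y ^ (p - 1) - 1 with hxdef
  -- `(x + 1)^p = u^{p−1}`
  have hx1 : (x + 1) ^ p = algebraMap ℚ_[p] K (u ^ (p - 1)) := by
    rw [hxdef, sub_add_cancel, ← pow_mul, mul_comm, pow_mul, hy, map_pow]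
  -- the coefficients of the Eisenstein polynomial
  set a : ℕ → ℚ_[p] := fun k => ((p.choose k : ℕ) : ℚ_[p]) - if k = 0 then u ^ (p - 1) else 0 with hadef
  have hroot : x ^ p + ∑ k ∈ Finset.range p, algebraMap ℚ_[p] K (a k) * x ^ k = 0 := by
    have hexp := add_pow x 1 p
    rw [Finset.sum_range_succ, Nat.choose_self, Nat.cast_one, mul_one, Nat.sub_self, pow_zero, mul_one] at hexp
    have h1 : ∀ k ∈ Finset.range p, algebraMap ℚ_[p] K (a k) * x ^ k =
        x ^ k * (1 : K) ^ (p - k) * ((p.choose k : ℕ) : K) -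
          (if k = 0 then algebraMap ℚ_[p] K (u ^ (p - 1)) * x ^ k else 0) := by
      intro k _
      simp only [hadef, map_sub, map_natCast, apply_ite (algebraMap ℚ_[p] K), map_zero, one_pow, mul_one]
      split_ifs with h0
      · ring
      · ring
    have hsum : ∑ k ∈ Finset.range p, algebraMap ℚ_[p] K (a k) * x ^ k =
        (∑ k ∈ Finset.range p, x ^ k * (1 : K) ^ (p - k) * ((p.choose k : ℕ) : K)) -
          algebraMap ℚ_[p] K (u ^ (p - 1)) := by
      rw [Finset.sum_congr rfl h1, Finset.sum_sub_distrib, Finset.sum_ite_eq']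
      simp [hpp.pos]
    rw [hsum, ← hx1, hexp]
    ring
  refine norm_eq_rpow_of_eisenstein_root p hpp.pos a (fun k hk => ?_) ?_ hroot
  · rcases Nat.eq_zero_or_pos k with rfl | hk0
    · simp only [hadef, if_true, Nat.choose_zero_right, Nat.cast_one]
      rw [norm_sub_rev, hu]
    · simp only [hadef, if_neg hk0.ne', sub_zero]
      exact Padic.norm_natCast_choose_le p hk0 hk
  · simp only [hadef, if_true, Nat.choose_zero_right, Nat.cast_one]
    rw [norm_sub_rev, hu]

end Eisenstein

/-! ## §2 `p ∣ e` and `d ≥ 1 + (e/p − 1)/e` -/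

section Unit

variable (p : ℕ) [Fact p.Prime]
variable {K : Type} [NontriviallyNormedField K] [NormedAlgebra ℚ_[p] K] [IsUltrametricDist K] [ProperSpace K]

/-- **`p ∣ e` from an element of norm `p^{−1/p}`**: the value group `p^{(1/e)ℤ}` of `K` contains `p^{−1/p}`.
[cite: SerreLocalFields1979, Ch. III §6 Prop. 13] -/
theorem prime_dvd_absRamificationIdx_of_norm_eq_rpow {x : K} (hx : ‖x‖ = (p : ℝ) ^ (-(1 / (p : ℝ)))) :
    p ∣ absRamificationIdx p K := by
  have hp1 : (1 : ℝ) < p := by exact_mod_cast (Fact.out : p.Prime).one_lt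
  have hp0 : (0 : ℝ) < p := by positivity
  have hx0 : x ≠ 0 := by
    intro h0
    rw [h0, norm_zero] at hx
    exact (Real.rpow_pos_of_pos hp0 _).ne hx
  obtain ⟨m, hm⟩ := exists_norm_eq_rpow p K hx0
  rw [hx] at hm
  have he0 : (0 : ℝ) < absRamificationIdx p K := by exact_mod_cast absRamificationIdx_pos p K
  have hexp : (1 / (p : ℝ)) = (m : ℝ) / (absRamificationIdx p K : ℝ) := by
    have h := congrArg (Real.logb p) hm
    rw [Real.logb_rpow hp0 hp1.ne', Real.logb_rpow hp0 hp1.ne'] at h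
    linarith
  have hmul : (absRamificationIdx p K : ℝ) = (m : ℝ) * p := by
    field_simp at hexp
    linarith
  have hint : (absRamificationIdx p K : ℤ) = m * p := by exact_mod_cast hmul
  have hdvd : (p : ℤ) ∣ (absRamificationIdx p K : ℤ) := ⟨m, by rw [hint, mul_comm]⟩
  exact_mod_cast hdvd

variable {u : ℚ_[p]} (hu : ‖u ^ (p - 1) - 1‖ = (p : ℝ)⁻¹) {y : K} (hy : y ^ p = algebraMap ℚ_[p] K u)

include hu hy

/-- **`(e + e/p − 1)/e ≤ d_K`** when `K ∋ y = u^{1/p}`, `u^{p−1} ≢ 1 (mod p²)`: the subfield `V = ℚ_p(y^{p−1} − 1) ⊆ K`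
has `[V : ℚ_p] ≤ p` and `p ∣ e_V`, so `e_V = p` and `d_V ≥ 1` (wild, `one_le_differentOrd_of_dvd`); then [IUTchIV] Prop. 1.3 (i)
(`prop13i_holds`: `d_K ≥ d_V + (e(K/V) − 1)/e_K`, `e(K/V) = e_K/p`). Equivalently `v_K(𝔇_{K/ℚ_p}) ≥ e + e/p − 1` (abc-iut W-num-2
N1-WILD-EXACT, type W2: `δ_w = 8e_t − 1` at `p = 3`, `24e_t − 1` at `p = 5`, EXACT).
[cite: SerreLocalFields1979, Ch. III §6 Prop. 13] [cite: Mochizuki2012, IUTchIV Prop. 1.3 (i) p. 11] -/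
theorem add_div_sub_one_div_le_differentOrd_of_pow_prime_eq_unit :
    ((absRamificationIdx p K + absRamificationIdx p K / p - 1 : ℕ) : ℝ) / (absRamificationIdx p K : ℝ) ≤
      differentOrd p K := by
  have hpp : p.Prime := Fact.out
  haveI : FiniteDimensional ℚ_[p] K := FiniteDimensional.of_locallyCompactSpace ℚ_[p]
  set x : K := y ^ (p - 1) - 1 with hxdef
  have hxn : ‖x‖ = (p : ℝ) ^ (-(1 / (p : ℝ))) := norm_pow_sub_one_pred_sub_one_of_pow_prime_eq_unit p hu hy
  -- the subfield `V = ℚ_p(x)`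
  haveI : FiniteDimensional ℚ_[p] ℚ_[p]⟮x⟯ := inferInstance
  haveI : ProperSpace ℚ_[p]⟮x⟯ := FiniteDimensional.proper ℚ_[p] ℚ_[p]⟮x⟯
  letI : NormedAlgebra ℚ_[p]⟮x⟯ K :=
    { (IntermediateField.toAlgebra ℚ_[p]⟮x⟯ : Algebra ℚ_[p]⟮x⟯ K) with
      norm_smul_le := fun v z => by
        rw [Algebra.smul_def, norm_mul]
        rfl }
  have hxV : x ∈ ℚ_[p]⟮x⟯ := IntermediateField.mem_adjoin_simple_self ℚ_[p] x
  -- `p ∣ e_V`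
  have hpV : p ∣ absRamificationIdx p ℚ_[p]⟮x⟯ :=
    prime_dvd_absRamificationIdx_of_norm_eq_rpow p (x := (⟨x, hxV⟩ : ℚ_[p]⟮x⟯)) hxn
  -- `[V : ℚ_p] ≤ p`: `x` is a root of `(X + 1)^p − u^{p−1}`
  have hx1 : (x + 1) ^ p = algebraMap ℚ_[p] K (u ^ (p - 1)) := by
    rw [hxdef, sub_add_cancel, ← pow_mul, mul_comm, pow_mul, hy, map_pow]
  have hdeg : Module.finrank ℚ_[p] ℚ_[p]⟮x⟯ ≤ p := by
    have hint : IsIntegral ℚ_[p] x := Algebra.IsIntegral.isIntegral x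
    rw [IntermediateField.adjoin.finrank hint]
    set g : ℚ_[p][X] := (X + C 1) ^ p - C (u ^ (p - 1)) with hgdef
    have hgdeg : g.natDegree = p := by
      rw [hgdef, natDegree_sub_C, natDegree_pow, natDegree_X_add_C, mul_one]
    have hg0 : g ≠ 0 := by
      intro h
      rw [h, natDegree_zero] at hgdeg
      exact hpp.ne_zero hgdeg.symm
    have hroot : aeval x g = 0 := by
      rw [hgdef, map_sub, map_pow, map_add, aeval_X, aeval_C, aeval_C, map_one, hx1, sub_self]
    calc (minpoly ℚ_[p] x).natDegree ≤ g.natDegree := natDegree_le_of_dvd (minpoly.dvd ℚ_[p] x hroot) hg0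
      _ = p := hgdeg
  -- `e_V = p`, `d_V ≥ 1`
  have heV : absRamificationIdx p ℚ_[p]⟮x⟯ = p := by
    have hfi := absRamificationIdx_mul_residueDegree p ℚ_[p]⟮x⟯
    have hf := residueDegree_pos p ℚ_[p]⟮x⟯
    have hle : absRamificationIdx p ℚ_[p]⟮x⟯ ≤ p := by
      calc absRamificationIdx p ℚ_[p]⟮x⟯ ≤ absRamificationIdx p ℚ_[p]⟮x⟯ * residueDegree p ℚ_[p]⟮x⟯ :=
            Nat.le_mul_of_pos_right _ hf
        _ = Module.finrank ℚ_[p] ℚ_[p]⟮x⟯ := hfi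
        _ ≤ p := hdeg
    exact le_antisymm hle (Nat.le_of_dvd (absRamificationIdx_pos p _) hpV)
  have hdV : 1 ≤ differentOrd p ℚ_[p]⟮x⟯ := one_le_differentOrd_of_dvd p ℚ_[p]⟮x⟯ hpV
  -- [IUTchIV] Prop 1.3 (i) on `K/V`
  obtain ⟨hle, -⟩ := prop13i_holds p ℚ_[p]⟮x⟯ K inferInstance
  have hrel : relRamificationIdx p ℚ_[p]⟮x⟯ K * p = absRamificationIdx p K := by
    have h := relRamificationIdx_mul p ℚ_[p]⟮x⟯ K
    rwa [heV] at h
  have hrel1 := relRamificationIdx_pos p ℚ_[p]⟮x⟯ K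
  set r := relRamificationIdx p ℚ_[p]⟮x⟯ K with hrdef
  have hdiv : absRamificationIdx p K / p = r := Nat.div_eq_of_eq_mul_left hpp.pos hrel.symm
  have he := absRamificationIdx_pos p K
  have he0 : (0 : ℝ) < absRamificationIdx p K := by exact_mod_cast he
  rw [hdiv]
  have hcast : ((absRamificationIdx p K + r - 1 : ℕ) : ℝ) = (absRamificationIdx p K : ℝ) + r - 1 := by
    rw [Nat.cast_sub (by omega), Nat.cast_add, Nat.cast_one]
  rw [hcast]
  calc ((absRamificationIdx p K : ℝ) + r - 1) / absRamificationIdx p K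
      = 1 + ((r : ℝ) - 1) / absRamificationIdx p K := by
        field_simp
        ring
    _ ≤ differentOrd p ℚ_[p]⟮x⟯ + ((r : ℝ) - 1) / absRamificationIdx p K := by gcongr
    _ ≤ differentOrd p K := hle

end Unit

end Literature.IUT.LogVolume

end
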